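import Literature.Algebra.Lie.ChevalleyEilenbergComplex
import HarnessLib

/-!
# Functoriality of the Chevalley–Eilenberg complex; equivariant cochains and the `(𝔤, K)`-complex

Topic `Algebra/Lie`; namespace `Literature.Algebra.Lie.ChevalleyEilenberg` (continues
`ChevalleyEilenbergComplex`: cochains `Cochain R L M q`, insertion `ins`, Lie derivative
`lieDer`, differential `d`, subcomplexes and their cohomology).  Definitions with bodies and
theorems only (no named fact, no `sorry`).

* **Change of Lie pair** (`pull`).  For a Lie algebra morphism `φ : L' → L` and an `R`-linear
  `ψ : M → M'` the cochain map `f ↦ ψ ∘ f ∘ φ^{×q}`; when the pair is COMPATIBLE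
  (`ψ ⁅φ x', m⁆ = ⁅x', ψ m⁆`, `Compatible`) it intertwines the Lie derivatives
  (`lieDer_pull`: `θ_{x'} ∘ (φ,ψ)^* = (φ,ψ)^* ∘ θ_{φ x'}`) and the differentials (`d_pull`), by
  induction on the degree through Cartan's formula.  Special cases: `φ = id` (change of
  coefficients, `map` of the first file), `ψ = id` (restriction to a subalgebra / inflation),
  and automorphisms [cite: BorelWallach2000, I §1.1]; `pull_id`, `pull_pull`.
* **Induced maps on cohomology** (`Subcomplex.IsCochainMapTo`, `cocyclesMap`, `cohomologyMap`):
  a family of linear maps commuting with `d` and carrying a subcomplex `S` (over `(L, M)`) into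
  a subcomplex `T` (over `(L', M')`) maps cocycles to cocycles and coboundaries to coboundaries
  and induces `H^q(S) → H^q(T)`; instances: inclusions of subcomplexes
  (`isCochainMapTo_id_of_le`, e.g. `C(𝔤, K; V) ⊆ C(𝔤, 𝔨; V) ⊆ C(𝔤; V)`), compatible changes of
  pair (`isCochainMapTo_pull_top`).
* **Group actions** (`PairAction`): a group `Γ` acting on `L` by Lie algebra endomorphisms
  `σ g` and on `M` linearly by `τ g`, multiplicatively and compatibly with the bracket
  (`τ g ⁅x, m⁆ = ⁅σ g x, τ g m⁆` — e.g. a compact group `K` acting on `𝔤` by `Ad` and on a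
  `(𝔤, K)`-module by `π`); the action `(g • f)(v) = τ(g) f(σ(g⁻¹) v)` on cochains
  (`PairAction.act`, a representation: `act_one`, `act_mul`) commutes with `d` (`d_act`) and is
  intertwined with `θ` (`lieDer_act`); the fixed cochains form a subcomplex (`fixedSubcomplex`).
* **Equivariant endomorphisms** (`PairAction.act_map`, `map_mem_rel`,
  `Subcomplex.isCochainMapTo_gK_map`, `gKCohomologyMap`): a morphism of `L`-modules `M → M`
  commuting with the `K`-action is a cochain map of the `(𝔤, K)`-complex and induces an
  endomorphism of `H^q(𝔤, 𝔨, K; M)` (how Hecke operators act on `(𝔤, K)`-cohomology).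
* **Composition / congruence** (`IsCochainMapTo.comp`, `cohomologyMap_comp`,
  `cohomologyMap_congr`, `cohomologyMap_comp₃_congr`): induced maps compose and depend only on
  the cochain map on the subcomplex (naturality squares).
* **The `(𝔤, K)`-complex** (`Subcomplex.gK K A = rel K ⊓ fixed A`): cochains that are relative
  for the Lie subalgebra `𝔨` (`i_x f = θ_x f = 0`, `x ∈ 𝔨`) and fixed by `K`; for a compact Lie
  group `K` with Lie algebra `𝔨` this is `C^q(𝔤, K; V) = Hom_K(Λ^q(𝔤/𝔨), V) = C^q(𝔤, 𝔨; V)^{K/K⁰}`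
  [cite: BorelWallach2000, I §5.1 (1)–(3)], and `gKCohomology K A q` is `H^q(𝔤, K; V)`
  [cite: BorelWallach2000, I §5.1 (4)] — the cohomology in which the Matsushima–Borel–Wallach /
  Eichler–Shimura–Harder descriptions of the cohomology of arithmetic groups are phrased
  (`H^•(Γ\X, Ṽ) = H^•(𝔤, K_∞; C^∞(Γ\G) ⊗ V)`, [cite: BorelWallach2000, VII]).

## Design notes

* Everything is over an arbitrary commutative ring `R`; `PairAction` records the two actions as
  functions with the monoid laws (no `Monoid` structure on `L →ₗ⁅R⁆ L` is assumed).
* In the abstract setting `θ_x f = 0 (x ∈ 𝔨)` is imposed in addition to `K`-fixedness; for a Lie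
  group `K` acting smoothly the former is the derivative of the latter on `K⁰`
  [cite: BorelWallach2000, I §5.1 (2)–(3)], so nothing is lost and no analysis is needed here.
* NOT here: the differentiation `K ↷ V ⇒ 𝔨 ↷ V` (needs the analytic `(𝔤, K)`-modules of
  `Literature.NumberTheory.Automorphic.GKModules`), long exact sequences, Künneth, Poincaré duality,
  Hochschild–Serre.

## References

* A. Borel, N. Wallach, *Continuous cohomology, discrete subgroups, and representations of
  reductive groups*, 2nd ed. (2000), Ch. I §1.1–1.2, §5.1 (1)–(4) (held, read 2026-08-16)
  [BorelWallach2000].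
* C. Chevalley, S. Eilenberg, Trans. AMS 63 (1948), §23, §28 [ChevalleyEilenberg1948].
-/

open Fin Function

namespace Literature.Algebra.Lie

namespace ChevalleyEilenberg

variable {R : Type*} [CommRing R] {L : Type*} [LieRing L] [LieAlgebra R L]
  {M : Type*} [AddCommGroup M] [Module R M]

/-! ### Change of Lie pair: pull-back/push-forward of cochains -/

section Pull

variable {L' : Type*} [LieRing L'] [LieAlgebra R L'] {M' : Type*} [AddCommGroup M'] [Module R M']

variable (L' M) in
/-- **Change of Lie pair.**  For a Lie algebra morphism `φ : L' → L` and an `R`-linear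
`ψ : M → M'`, the cochain map `f ↦ ψ ∘ f ∘ φ^{×q}`, `C^q(L; M) → C^q(L'; M')`.
[cite: BorelWallach2000, I §1.1] -/
def pull (φ : L' →ₗ⁅R⁆ L) (ψ : M →ₗ[R] M') (q : ℕ) : Cochain R L M q →ₗ[R] Cochain R L' M' q where
  toFun f := ψ.compAlternatingMap (f.compLinearMap (φ : L' →ₗ[R] L))
  map_add' f g := by ext v; simp
  map_smul' c f := by ext v; simp

/-- `((φ, ψ)^* f)(v) = ψ (f (φ ∘ v))`. [folklore] -/
@[simp] theorem pull_apply (φ : L' →ₗ⁅R⁆ L) (ψ : M →ₗ[R] M') (q : ℕ) (f : Cochain R L M q)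
    (v : Fin q → L') : pull M L' φ ψ q f v = ψ (f (φ ∘ v)) := rfl

/-- Insertion under change of pair: `i_{x'} (φ,ψ)^* = (φ,ψ)^* i_{φ x'}`. [folklore] -/
theorem ins_pull (φ : L' →ₗ⁅R⁆ L) (ψ : M →ₗ[R] M') (q : ℕ) (x' : L')
    (f : Cochain R L M (q + 1)) :
    ins q x' (pull M L' φ ψ (q + 1) f) = pull M L' φ ψ q (ins q (φ x') f) := by
  ext v
  simp only [ins_apply, pull_apply]
  congr 2
  ext i
  cases i using Fin.cases <;> simp [Matrix.vecCons]

variable [LieRingModule L M] [LieRingModule L' M']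

/-- `(φ, ψ)` is a **compatible pair**: `ψ ⁅φ x', m⁆ = ⁅x', ψ m⁆`, i.e. `ψ` is `L'`-equivariant
for the `L'`-module structure on `M` pulled back along `φ`. [folklore] -/
def Compatible (φ : L' →ₗ⁅R⁆ L) (ψ : M →ₗ[R] M') : Prop :=
  ∀ (x' : L') (m : M), ψ ⁅φ x', m⁆ = ⁅x', ψ m⁆

variable [LieModule R L M] [LieModule R L' M']

/-- The Lie derivative is natural under compatible changes of Lie pair. [folklore] -/
theorem lieDer_pull {φ : L' →ₗ⁅R⁆ L} {ψ : M →ₗ[R] M'} (h : Compatible φ ψ) (q : ℕ) (x' : L')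
    (f : Cochain R L M q) :
    lieDer R L' M' q x' (pull M L' φ ψ q f) = pull M L' φ ψ q (lieDer R L M q (φ x') f) := by
  induction q generalizing x' with
  | zero =>
    ext v
    simp only [pull_apply]
    exact (h _ _).symm
  | succ q ih =>
    refine ext_ins fun y' => ?_
    rw [ins_lieDer, ins_pull, ih, ins_pull, ins_pull, ins_lieDer, map_sub, LieHom.map_lie]

/-- **The differential is natural under compatible changes of Lie pair**:
`d ∘ (φ, ψ)^* = (φ, ψ)^* ∘ d`. [folklore] -/
theorem d_pull {φ : L' →ₗ⁅R⁆ L} {ψ : M →ₗ[R] M'} (h : Compatible φ ψ) (q : ℕ)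
    (f : Cochain R L M q) :
    d R L' M' q (pull M L' φ ψ q f) = pull M L' φ ψ (q + 1) (d R L M q f) := by
  induction q with
  | zero =>
    refine ext_ins fun y' => ?_
    rw [ins_d_zero, lieDer_pull h, ins_pull, ins_d_zero]
  | succ q ih =>
    refine ext_ins fun y' => ?_
    rw [ins_d_succ, lieDer_pull h, ins_pull, ih, ins_pull, ins_d_succ, map_sub]

end Pull

section PullComp

/-- `(id, id)^* = id`. [folklore] -/
theorem pull_id (q : ℕ) (f : Cochain R L M q) :
    pull M L (LieHom.id : L →ₗ⁅R⁆ L) (LinearMap.id : M →ₗ[R] M) q f = f := by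
  ext v; rfl

variable {L' : Type*} [LieRing L'] [LieAlgebra R L'] {M' : Type*} [AddCommGroup M'] [Module R M']
  {L'' : Type*} [LieRing L''] [LieAlgebra R L''] {M'' : Type*} [AddCommGroup M''] [Module R M'']

/-- Composition of changes of Lie pair. [folklore] -/
theorem pull_pull (φ : L' →ₗ⁅R⁆ L) (ψ : M →ₗ[R] M') (φ' : L'' →ₗ⁅R⁆ L') (ψ' : M' →ₗ[R] M'')
    (q : ℕ) (f : Cochain R L M q) :
    pull M' L'' φ' ψ' q (pull M L' φ ψ q f) = pull M L'' (φ.comp φ') (ψ'.comp ψ) q f := by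
  ext v; rfl

end PullComp


/-! ### Induced maps on cohomology -/

section CohomologyMap

variable [LieRingModule L M] [LieModule R L M]
  {L' : Type*} [LieRing L'] [LieAlgebra R L'] {M' : Type*} [AddCommGroup M'] [Module R M']
  [LieRingModule L' M'] [LieModule R L' M']

/-- A family of linear maps `F_q : C^q(L; M) → C^q(L'; M')` commuting with the differentials
and mapping the subcomplex `S` into the subcomplex `T` (a morphism of complexes `S → T`).
[folklore] -/
structure Subcomplex.IsCochainMapTo (S : Subcomplex R L M) (T : Subcomplex R L' M')
    (F : (q : ℕ) → Cochain R L M q →ₗ[R] Cochain R L' M' q) : Prop where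
  /-- `d ∘ F = F ∘ d` -/
  comm : ∀ (q : ℕ) (f : Cochain R L M q), d R L' M' q (F q f) = F (q + 1) (d R L M q f)
  /-- `F(S_q) ⊆ T_q` -/
  mapsTo : ∀ (q : ℕ) (f : Cochain R L M q), f ∈ S.carrier q → F q f ∈ T.carrier q

namespace Subcomplex.IsCochainMapTo

variable {S : Subcomplex R L M} {T : Subcomplex R L' M'}
  {F : (q : ℕ) → Cochain R L M q →ₗ[R] Cochain R L' M' q} (h : S.IsCochainMapTo T F)
include h

/-- A cochain map carries cocycles of `S` to cocycles of `T`. [folklore] -/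
theorem mapsTo_cocycles (q : ℕ) (f : Cochain R L M q) (hf : f ∈ S.cocycles q) :
    F q f ∈ T.cocycles q := by
  rw [Subcomplex.mem_cocycles_iff] at hf ⊢
  exact ⟨h.mapsTo q f hf.1, by rw [h.comm, hf.2, map_zero]⟩

/-- A cochain map carries coboundaries of `S` to coboundaries of `T`. [folklore] -/
theorem mapsTo_coboundaries (q : ℕ) (f : Cochain R L M q) (hf : f ∈ S.coboundaries q) :
    F q f ∈ T.coboundaries q := by
  cases q with
  | zero =>
    change f ∈ (⊥ : Submodule R _) at hf
    rw [Submodule.mem_bot] at hf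
    rw [hf, map_zero]
    exact Submodule.zero_mem _
  | succ q =>
    obtain ⟨g, hg, rfl⟩ := (S.mem_coboundaries_succ_iff q f).1 hf
    exact (T.mem_coboundaries_succ_iff q _).2 ⟨F q g, h.mapsTo q g hg, h.comm q g⟩

/-- The map on cocycles. [folklore] -/
def cocyclesMap (q : ℕ) : S.cocycles q →ₗ[R] T.cocycles q :=
  (F q).restrict fun f hf => h.mapsTo_cocycles q f hf

/-- The map on cocycles is `F` on underlying cochains. [folklore] -/
@[simp] theorem coe_cocyclesMap (q : ℕ) (z : S.cocycles q) :
    (h.cocyclesMap q z : Cochain R L' M' q) = F q z := rfl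

/-- **The induced map on cohomology** `H^q(S) → H^q(T)`. [folklore] -/
def cohomologyMap (q : ℕ) : S.Cohomology q →ₗ[R] T.Cohomology q :=
  Submodule.mapQ _ _ (h.cocyclesMap q) fun z hz => by
    rw [Submodule.mem_comap, Submodule.subtype_apply] at hz
    rw [Submodule.mem_comap]
    exact h.mapsTo_coboundaries q _ hz

/-- The induced map sends the class of `z` to the class of `F z`. [folklore] -/
theorem cohomologyMap_toCohomology (q : ℕ) (z : S.cocycles q) :
    h.cohomologyMap q (S.toCohomology q z) = T.toCohomology q (h.cocyclesMap q z) := rfl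

end Subcomplex.IsCochainMapTo

/-- The identity is a cochain map from `S` to any larger subcomplex (e.g. from the
`(𝔤, K)`-complex to the `(𝔤, 𝔨)`-complex, or to all cochains).
[cite: BorelWallach2000, I §5.1 (2)] -/
theorem Subcomplex.isCochainMapTo_id_of_le {S T : Subcomplex R L M}
    (hST : ∀ q, S.carrier q ≤ T.carrier q) :
    S.IsCochainMapTo T fun _ => LinearMap.id :=
  ⟨fun _ _ => rfl, fun q _ hf => hST q hf⟩

/-- A compatible change of Lie pair `(φ, ψ)` is a cochain map between the full complexes
(restriction/inflation in Lie algebra cohomology). [folklore] -/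
theorem Subcomplex.isCochainMapTo_pull_top {φ : L' →ₗ⁅R⁆ L} {ψ : M →ₗ[R] M'}
    (hc : Compatible φ ψ) :
    (Subcomplex.top R L M).IsCochainMapTo (Subcomplex.top R L' M') (pull M L' φ ψ) :=
  ⟨fun q f => d_pull hc q f, fun _ _ _ => trivial⟩

end CohomologyMap

/-! ### Group actions on the pair `(L, M)`; equivariant cochains; the `(𝔤, K)`-complex -/

section GroupAction

variable [LieRingModule L M] {Γ : Type*} [Group Γ]

variable (R L M) in
/-- A group `Γ` acting on the Lie algebra `L` by Lie algebra endomorphisms `σ g` and `R`-linearly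
on `M` by `τ g`, multiplicatively, and compatibly with the bracket:
`τ g ⁅x, m⁆ = ⁅σ g x, τ g m⁆` (e.g. a compact group `K` acting by `Ad` on `𝔤` and by `π|_K` on a
`(𝔤, K)`-module). [cite: BorelWallach2000, I §5.1] -/
structure PairAction (Γ : Type*) [Group Γ] where
  /-- the action on the Lie algebra -/
  σ : Γ → (L →ₗ⁅R⁆ L)
  /-- the action on the module -/
  τ : Γ → (M →ₗ[R] M)
  /-- `σ 1 = id` -/
  σ_one : σ 1 = LieHom.id
  /-- `σ (g h) = σ g ∘ σ h` -/
  σ_mul : ∀ g h, σ (g * h) = (σ g).comp (σ h)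
  /-- `τ 1 = id` -/
  τ_one : τ 1 = LinearMap.id
  /-- `τ (g h) = τ g ∘ τ h` -/
  τ_mul : ∀ g h, τ (g * h) = (τ g).comp (τ h)
  /-- compatibility with the bracket -/
  compat : ∀ (g : Γ) (x : L) (m : M), τ g ⁅x, m⁆ = ⁅σ g x, τ g m⁆

namespace PairAction

variable (A : PairAction R L M Γ)

/-- `σ(g) σ(g⁻¹) = id`. [folklore] -/
theorem σ_inv_apply (g : Γ) (x : L) : A.σ g (A.σ g⁻¹ x) = x := by
  rw [← LieHom.comp_apply, ← A.σ_mul, mul_inv_cancel, A.σ_one, LieHom.id_apply]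

/-- `σ(g⁻¹) σ(g) = id`. [folklore] -/
theorem σ_apply_inv (g : Γ) (x : L) : A.σ g⁻¹ (A.σ g x) = x := by
  rw [← LieHom.comp_apply, ← A.σ_mul, inv_mul_cancel, A.σ_one, LieHom.id_apply]

/-- The action of `g ∈ Γ` on cochains: `(g • f)(v) = τ(g) f(σ(g⁻¹) v)`.
[cite: BorelWallach2000, I §5.1 (1)] -/
def act (g : Γ) (q : ℕ) : Cochain R L M q →ₗ[R] Cochain R L M q :=
  pull M L (A.σ g⁻¹) (A.τ g) q

/-- `(g • f)(v) = τ(g) f(σ(g⁻¹) v)`. [cite: BorelWallach2000, I §5.1 (1)] -/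
@[simp] theorem act_apply (g : Γ) (q : ℕ) (f : Cochain R L M q) (v : Fin q → L) :
    A.act g q f v = A.τ g (f (fun i => A.σ g⁻¹ (v i))) := rfl

/-- `(σ(g⁻¹), τ(g))` is a compatible pair. [folklore] -/
theorem compatible (g : Γ) : Compatible (A.σ g⁻¹) (A.τ g) := by
  intro x m
  rw [A.compat, σ_inv_apply]

/-- `1 • f = f`. [folklore] -/
@[simp] theorem act_one (q : ℕ) (f : Cochain R L M q) : A.act 1 q f = f := by
  ext v
  simp [act_apply, inv_one, A.σ_one, A.τ_one]

/-- `(g h) • f = g • (h • f)`. [folklore] -/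
theorem act_mul (g h : Γ) (q : ℕ) (f : Cochain R L M q) :
    A.act (g * h) q f = A.act g q (A.act h q f) := by
  ext v
  simp [act_apply, mul_inv_rev, A.σ_mul, A.τ_mul]

/-- Insertion under the action: `i_x (g • f) = g • i_{σ(g⁻¹) x} f`. [folklore] -/
theorem ins_act (g : Γ) (q : ℕ) (x : L) (f : Cochain R L M (q + 1)) :
    ins q x (A.act g (q + 1) f) = A.act g q (ins q (A.σ g⁻¹ x) f) :=
  ins_pull _ _ q x f

/-- `Γ`-fixed cochains `C^q(L; M)^Γ`. [cite: BorelWallach2000, I §5.1 (3)] -/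
def fixed (q : ℕ) : Submodule R (Cochain R L M q) :=
  ⨅ g : Γ, LinearMap.eqLocus (A.act g q) LinearMap.id

/-- `f` is fixed iff `g • f = f` for all `g`. [folklore] -/
theorem mem_fixed_iff (q : ℕ) (f : Cochain R L M q) :
    f ∈ A.fixed q ↔ ∀ g : Γ, A.act g q f = f := by
  simp only [fixed, Submodule.mem_iInf, LinearMap.mem_eqLocus, LinearMap.id_apply]

variable [LieModule R L M]

/-- The Lie derivative is `Γ`-equivariant: `θ_x (g • f) = g • θ_{σ(g⁻¹) x} f`. [folklore] -/
theorem lieDer_act (g : Γ) (q : ℕ) (x : L) (f : Cochain R L M q) :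
    lieDer R L M q x (A.act g q f) = A.act g q (lieDer R L M q (A.σ g⁻¹ x) f) :=
  lieDer_pull (A.compatible g) q x f

/-- **The differential is `Γ`-equivariant**: `d (g • f) = g • d f`.
[cite: BorelWallach2000, I §5.1] -/
theorem d_act (g : Γ) (q : ℕ) (f : Cochain R L M q) :
    d R L M q (A.act g q f) = A.act g (q + 1) (d R L M q f) :=
  d_pull (A.compatible g) q f

/-- **The subcomplex of `Γ`-fixed cochains.** [cite: BorelWallach2000, I §5.1 (3)] -/
def fixedSubcomplex : Subcomplex R L M where
  carrier := A.fixed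
  d_mem q f hf := by
    rw [mem_fixed_iff] at hf ⊢
    intro g
    rw [← d_act, hf g]

end PairAction

/-- Intersection of two subcomplexes. [folklore] -/
def Subcomplex.inf [LieModule R L M] (S T : Subcomplex R L M) : Subcomplex R L M where
  carrier q := S.carrier q ⊓ T.carrier q
  d_mem q f hf := Submodule.mem_inf.2
    ⟨S.d_mem q f (Submodule.mem_inf.1 hf).1, T.d_mem q f (Submodule.mem_inf.1 hf).2⟩

variable (R L M) in
/-- **The `(𝔤, K)`-complex `C^•(𝔤, 𝔨, K; V)`**: cochains that are relative for the Lie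
subalgebra `𝔨` (`i_x f = 0`, `θ_x f = 0` for `x ∈ 𝔨`) AND fixed under the compatible action of
the group `K` (`k • f = f`).  When `K` is a compact Lie group with Lie algebra `𝔨` acting on
`𝔤` by `Ad` and on `V` as a `(𝔤, K)`-module, this is `Hom_K(Λ^•(𝔤/𝔨), V) = C^•(𝔤, 𝔨; V)^{K/K⁰}`,
whose cohomology is `H^•(𝔤, K; V)`. [cite: BorelWallach2000, I §5.1 (1)–(3)] -/
def Subcomplex.gK [LieModule R L M] (K : LieSubalgebra R L) (A : PairAction R L M Γ) :
    Subcomplex R L M :=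
  (Subcomplex.rel R L M K).inf A.fixedSubcomplex

variable (R L M) in
/-- **`(𝔤, K)`-cohomology `H^q(𝔤, 𝔨, K; V)`** of the `(𝔤, K)`-complex.
[cite: BorelWallach2000, I §5.1 (4)] -/
abbrev gKCohomology [LieModule R L M] (K : LieSubalgebra R L) (A : PairAction R L M Γ) (q : ℕ) :
    Type _ :=
  (Subcomplex.gK R L M K A).Cohomology q

/-- Membership in the `(𝔤, K)`-complex: relative for `𝔨` and fixed by `K`.
[cite: BorelWallach2000, I §5.1 (1)–(3)] -/
theorem Subcomplex.mem_gK_iff [LieModule R L M] (K : LieSubalgebra R L) (A : PairAction R L M Γ)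
    (q : ℕ) (f : Cochain R L M q) :
    f ∈ (Subcomplex.gK R L M K A).carrier q ↔
      f ∈ (Subcomplex.rel R L M K).carrier q ∧ ∀ g : Γ, A.act g q f = f := by
  change f ∈ (Subcomplex.rel R L M K).carrier q ⊓ A.fixed q ↔ _
  rw [Submodule.mem_inf, A.mem_fixed_iff]

end GroupAction

/-! ### Equivariant module endomorphisms act on the `(𝔤, K)`-complex and its cohomology -/

section EquivariantMap

variable [LieRingModule L M] {Γ : Type*} [Group Γ]

/-- A morphism of `L`-modules `φ : M → M` commuting with the group action `τ` commutes with the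
action on cochains: `g • (φ_* f) = φ_* (g • f)`. [folklore] -/
theorem PairAction.act_map (A : PairAction R L M Γ) (φ : M →ₗ⁅R,L⁆ M)
    (hφ : ∀ g : Γ, (A.τ g).comp (φ : M →ₗ[R] M) = (φ : M →ₗ[R] M).comp (A.τ g)) (g : Γ) (q : ℕ)
    (f : Cochain R L M q) : A.act g q (map L φ q f) = map L φ q (A.act g q f) := by
  ext v
  simp only [PairAction.act_apply, map_apply]
  exact LinearMap.congr_fun (hφ g) _

variable [LieModule R L M]

/-- `φ_*` preserves the relative cochains of a Lie subalgebra (it commutes with `i_x` and `θ_x`).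
[cite: BorelWallach2000, I §1.2] -/
theorem map_mem_rel (K : LieSubalgebra R L) (φ : M →ₗ⁅R,L⁆ M) (q : ℕ) (f : Cochain R L M q)
    (hf : f ∈ (Subcomplex.rel R L M K).carrier q) :
    map L φ q f ∈ (Subcomplex.rel R L M K).carrier q := by
  cases q with
  | zero =>
    rw [Subcomplex.mem_rel_zero_iff] at hf ⊢
    intro x hx
    rw [lieDer_map, hf x hx, map_zero]
  | succ q =>
    rw [Subcomplex.mem_rel_succ_iff] at hf ⊢
    intro x hx
    refine ⟨?_, ?_⟩
    · rw [lieDer_map, (hf x hx).1, map_zero]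
    · rw [ins_map, (hf x hx).2, map_zero]

/-- **An equivariant module endomorphism is a cochain map of the `(𝔤, K)`-complex**: a morphism
of `L`-modules `φ : M → M` commuting with the `K`-action maps `C^•(𝔤, 𝔨, K; M)` to itself and
commutes with `d` — the mechanism by which operators commuting with `(𝔤, K)` (e.g. Hecke
operators / `G(𝔸_f)` on `C^∞(G(ℚ)\G(𝔸)) ⊗ E`) act on `(𝔤, K)`-cohomology.
[cite: BorelWallach2000, I §5.1] -/
theorem Subcomplex.isCochainMapTo_gK_map (K : LieSubalgebra R L) (A : PairAction R L M Γ)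
    (φ : M →ₗ⁅R,L⁆ M)
    (hφ : ∀ g : Γ, (A.τ g).comp (φ : M →ₗ[R] M) = (φ : M →ₗ[R] M).comp (A.τ g)) :
    (Subcomplex.gK R L M K A).IsCochainMapTo (Subcomplex.gK R L M K A) (map L φ) where
  comm q f := d_map φ q f
  mapsTo q f hf := by
    rw [Subcomplex.mem_gK_iff] at hf ⊢
    refine ⟨map_mem_rel K φ q f hf.1, fun g => ?_⟩
    rw [PairAction.act_map A φ hφ, hf.2 g]

/-- **The endomorphism of `H^q(𝔤, 𝔨, K; M)` induced by an equivariant module endomorphism.**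
[cite: BorelWallach2000, I §5.1] -/
def gKCohomologyMap (K : LieSubalgebra R L) (A : PairAction R L M Γ) (φ : M →ₗ⁅R,L⁆ M)
    (hφ : ∀ g : Γ, (A.τ g).comp (φ : M →ₗ[R] M) = (φ : M →ₗ[R] M).comp (A.τ g)) (q : ℕ) :
    gKCohomology R L M K A q →ₗ[R] gKCohomology R L M K A q :=
  (Subcomplex.isCochainMapTo_gK_map K A φ hφ).cohomologyMap q

/-- The induced endomorphism on the class of a cocycle `z` is the class of `φ ∘ z`. [folklore] -/
theorem gKCohomologyMap_toCohomology (K : LieSubalgebra R L) (A : PairAction R L M Γ)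
    (φ : M →ₗ⁅R,L⁆ M)
    (hφ : ∀ g : Γ, (A.τ g).comp (φ : M →ₗ[R] M) = (φ : M →ₗ[R] M).comp (A.τ g)) (q : ℕ)
    (z : (Subcomplex.gK R L M K A).cocycles q) :
    gKCohomologyMap K A φ hφ q ((Subcomplex.gK R L M K A).toCohomology q z) =
      (Subcomplex.gK R L M K A).toCohomology q
        ((Subcomplex.isCochainMapTo_gK_map K A φ hφ).cocyclesMap q z) := rfl

end EquivariantMap

/-! ### Composition and congruence of induced maps -/

section Composition

variable [LieRingModule L M] [LieModule R L M]
  {L' : Type*} [LieRing L'] [LieAlgebra R L'] {M' : Type*} [AddCommGroup M'] [Module R M']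
  [LieRingModule L' M'] [LieModule R L' M']
  {L'' : Type*} [LieRing L''] [LieAlgebra R L''] {M'' : Type*} [AddCommGroup M''] [Module R M'']
  [LieRingModule L'' M''] [LieModule R L'' M'']

/-- Composition of cochain maps. [folklore] -/
theorem Subcomplex.IsCochainMapTo.comp {S : Subcomplex R L M} {T : Subcomplex R L' M'}
    {U : Subcomplex R L'' M''} {F : (q : ℕ) → Cochain R L M q →ₗ[R] Cochain R L' M' q}
    {G : (q : ℕ) → Cochain R L' M' q →ₗ[R] Cochain R L'' M'' q}
    (hF : S.IsCochainMapTo T F) (hG : T.IsCochainMapTo U G) :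
    S.IsCochainMapTo U (fun q => (G q).comp (F q)) :=
  ⟨fun q f => by rw [LinearMap.comp_apply, hG.comm, hF.comm, LinearMap.comp_apply],
    fun q f hf => hG.mapsTo q _ (hF.mapsTo q f hf)⟩

/-- Induced maps compose: `H(G) ∘ H(F) = H(G ∘ F)`. [folklore] -/
theorem Subcomplex.IsCochainMapTo.cohomologyMap_comp {S : Subcomplex R L M} {T : Subcomplex R L' M'}
    {U : Subcomplex R L'' M''} {F : (q : ℕ) → Cochain R L M q →ₗ[R] Cochain R L' M' q}
    {G : (q : ℕ) → Cochain R L' M' q →ₗ[R] Cochain R L'' M'' q}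
    (hF : S.IsCochainMapTo T F) (hG : T.IsCochainMapTo U G) (q : ℕ) (x : S.Cohomology q) :
    hG.cohomologyMap q (hF.cohomologyMap q x) = (hF.comp hG).cohomologyMap q x := by
  obtain ⟨z, rfl⟩ := S.toCohomology_surjective q x
  rfl

/-- Induced maps only depend on the cochain map on the subcomplex. [folklore] -/
theorem Subcomplex.IsCochainMapTo.cohomologyMap_congr {S : Subcomplex R L M}
    {T : Subcomplex R L' M'} {F F' : (q : ℕ) → Cochain R L M q →ₗ[R] Cochain R L' M' q}
    (hF : S.IsCochainMapTo T F) (hF' : S.IsCochainMapTo T F')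
    (h : ∀ (q : ℕ) (f : Cochain R L M q), f ∈ S.carrier q → F q f = F' q f) (q : ℕ)
    (x : S.Cohomology q) : hF.cohomologyMap q x = hF'.cohomologyMap q x := by
  obtain ⟨z, rfl⟩ := S.toCohomology_surjective q x
  rw [hF.cohomologyMap_toCohomology, hF'.cohomologyMap_toCohomology]
  congr 1
  ext1
  rw [hF.coe_cocyclesMap, hF'.coe_cocyclesMap]
  exact h q z.1 ((S.mem_cocycles_iff q _).1 z.2).1

/-- Two chains of three cochain maps that agree pointwise on `S`-cochains induce the same map on
cohomology (used for naturality squares whose sides are composites). [folklore] -/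
theorem Subcomplex.IsCochainMapTo.cohomologyMap_comp₃_congr
    {L₁ : Type*} [LieRing L₁] [LieAlgebra R L₁] {M₁ : Type*} [AddCommGroup M₁] [Module R M₁]
    [LieRingModule L₁ M₁] [LieModule R L₁ M₁]
    {L₂ : Type*} [LieRing L₂] [LieAlgebra R L₂] {M₂ : Type*} [AddCommGroup M₂] [Module R M₂]
    [LieRingModule L₂ M₂] [LieModule R L₂ M₂]
    {L₃ : Type*} [LieRing L₃] [LieAlgebra R L₃] {M₃ : Type*} [AddCommGroup M₃] [Module R M₃]
    [LieRingModule L₃ M₃] [LieModule R L₃ M₃]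
    {S : Subcomplex R L M} {T₁ : Subcomplex R L' M'} {T₂ : Subcomplex R L₁ M₁}
    {T₁' : Subcomplex R L₂ M₂} {T₂' : Subcomplex R L₃ M₃} {U : Subcomplex R L'' M''}
    {F₁ : (q : ℕ) → Cochain R L M q →ₗ[R] Cochain R L' M' q}
    {F₂ : (q : ℕ) → Cochain R L' M' q →ₗ[R] Cochain R L₁ M₁ q}
    {F₃ : (q : ℕ) → Cochain R L₁ M₁ q →ₗ[R] Cochain R L'' M'' q}
    {F₁' : (q : ℕ) → Cochain R L M q →ₗ[R] Cochain R L₂ M₂ q}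
    {F₂' : (q : ℕ) → Cochain R L₂ M₂ q →ₗ[R] Cochain R L₃ M₃ q}
    {F₃' : (q : ℕ) → Cochain R L₃ M₃ q →ₗ[R] Cochain R L'' M'' q}
    (h₁ : S.IsCochainMapTo T₁ F₁) (h₂ : T₁.IsCochainMapTo T₂ F₂) (h₃ : T₂.IsCochainMapTo U F₃)
    (h₁' : S.IsCochainMapTo T₁' F₁') (h₂' : T₁'.IsCochainMapTo T₂' F₂')
    (h₃' : T₂'.IsCochainMapTo U F₃')
    (h : ∀ (q : ℕ) (f : Cochain R L M q), f ∈ S.carrier q →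
      F₃ q (F₂ q (F₁ q f)) = F₃' q (F₂' q (F₁' q f))) (q : ℕ) (x : S.Cohomology q) :
    h₃.cohomologyMap q (h₂.cohomologyMap q (h₁.cohomologyMap q x)) =
      h₃'.cohomologyMap q (h₂'.cohomologyMap q (h₁'.cohomologyMap q x)) := by
  obtain ⟨z, rfl⟩ := S.toCohomology_surjective q x
  simp only [Subcomplex.IsCochainMapTo.cohomologyMap_toCohomology]
  congr 1
  ext1
  simp only [Subcomplex.IsCochainMapTo.coe_cocyclesMap]
  exact h q z.1 ((S.mem_cocycles_iff q _).1 z.2).1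

end Composition

end ChevalleyEilenberg

end Literature.Algebra.Lie
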